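import Literature.Probability.RandomPlanarGeometry.LoewnerSemigroup
import Literature.Probability.RandomPlanarGeometry.KernelConvergence
import Mathlib.Analysis.Complex.LocallyUniformLimit
import HarnessLib

/-!
# The semigroup `𝒜₀`, the convergence of [LSW] Lemma 3.5, and the density of `𝒜₀` in `𝒬₊`

G. F. Lawler, O. Schramm, W. Werner, *Conformal restriction: the chordal case*, J. Amer. Math.
Soc. **16** (2003) 917–955, arXiv:math/0209343 (**[LSW]**), proof of Prop. 3.3 (arXiv pp. 11–13).
After `F(G_t^λ) = G_t'(0)^α` on the generators (p. 11: "We may therefore conclude that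
`F(Φ_A) = Φ_A'(0)^α` for every `A` in the semigroup `𝒜₀` generated by `{λK_t : t ≥ 0, λ > 0}`"),
the extension to `𝒬₊` "relies on the following lemma":

> **Lemma 3.5.** There exists a topology on `𝒬₊` for which `𝒜₀` is dense, `F` is continuous,
> and `Φ_A ↦ Φ_A'(0)` is continuous.

and its proof begins: "Given `A ∈ 𝒬₊` and a sequence `{A_n} ⊂ 𝒬₊`, we say that `A_n ∈ 𝒬₊`
converges to `A ∈ 𝒬₊` if `Φ_{A_n}` converges to `Φ_A` uniformly on compact subsets of `ℍ̄ ∖ A`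
and `⋃ₙ A_n` is bounded away from `0` and `∞`. (This is very closely related to what is known
as the Carathéodory topology.)" and ends (p. 13): "Hence, `𝒜₀` is dense in `𝒬₊` and Lemma 3.5
is established."

This file vendors the objects of that lemma and isolates its one deep ingredient:

* `Literature.IsLSWGenerated A` — **`A ∈ 𝒜₀`**, the semigroup generated by the dilated Loewner hulls
  `λK_t` (`LoewnerSemigroup`: `lswHull`, `K_{s+t} = K_t · K_s`) under the product `A · A'` of
  `𝒬*` (`RestrictionConfig.IsHullProduct`, `Φ_{A·A'} = Φ_A ∘ Φ_{A'}`), as an inductive predicate;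
* `Literature.LSWConverges A Φ An Φn` — **`A_n → A` in the sense of the proof of Lemma 3.5**: `⋃ A_n`
  bounded away from `0` and `∞`; for every compact `S ⊆ ℍ ∖ A`: `S ∩ A_n = ∅` eventually (so
  that the maps are defined on `S`) and `Φ_{A_n} → Φ_A` uniformly on `S`; and `Φ_{A_n} → Φ_A`
  uniformly on a half-disc `B(0, ρ) ∩ ℍ` about the boundary point `0` (equivalently, for the
  continuous boundary extensions, on the compact `B̄(0, ρ') ∩ ℍ̄`). The printed "compact subsets
  of `ℍ̄ ∖ A`" is thus taken on the open set and at the marked boundary point `0` — the only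
  boundary points at which the proof uses it ("the maps may be extended to a neighborhood of `0`
  by Schwarz reflection"); real points of the segment `[x₀, x₁]` spanned by `A ∩ ℝ` must be
  excluded in any case (they lie in all the approximating hulls `E_δ ⊇ A' = A ∪ [x₀, x₁]` of the
  printed proof, p. 13);
* `Literature.Probability.RandomPlanarGeometry.IsPlusHull.exists_isLSWGenerated_lswConverges` — NAMED FACT, **the density of `𝒜₀` in
  `𝒬₊`** for this convergence (the Loewner-equation part of the proof of Lemma 3.5, pp. 12–13:
  `E_δ → A`, the boundary slit of `E_δ` has a continuous Loewner driving function, which is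
  approximated by step functions, whose hulls lie in `𝒜₀`). Not proved here.

and PROVES the two elementary consequences used in the proof of Prop. 3.3:

* `Literature.Probability.RandomPlanarGeometry.LSWConverges.tendsto_restrictionDeriv` — **`Φ'_{A_n}(0) → Φ'_A(0)`** ("immediate … by
  Cauchy's derivative formula (the maps may be extended to a neighborhood of `0` by Schwarz
  reflection in the real line)", p. 12): the reflected extensions (`reflectExt`,
  `KernelConvergence`) converge uniformly on a disc about `0`, hence so do their derivatives;
* `Literature.Probability.RandomPlanarGeometry.IsLSWGenerated.measure_avoid_eq_rpow` — **`F = Φ'(0)^α` on `𝒜₀`**: if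
  `F(A) = P[K ∩ A = ∅]` is multiplicative over products and dilation invariant
  (`RestrictionConfig.IsHullMultiplicative`, `IsScaleInvariant`) and `F(K_t) = e^{-2αt}`, then
  `F(A) = Φ'_A(0)^α` for all `A ∈ 𝒜₀` (p. 11), by `Φ'_{λK_t}(0) = e^{-2t}`
  (`hasRestrictionDeriv_smul_lswHull`) and the chain rule `Φ'_{A·A'}(0) = Φ'_A(0) Φ'_{A'}(0)`
  (`HasRestrictionDeriv.hullProduct`).

The continuity of `F` in this convergence (the probabilistic half of Lemma 3.5) is the named
fact `LSWConverges.tendsto_measure_avoid` of `RestrictionContinuity`, discharged in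
`RestrictionContinuityProofs` (`LSWConverges.tendsto_measure_avoid_holds`); the assembly of
Prop. 3.3 (1) ⇒ (3) from the two clauses of Lemma 3.5 is `RestrictionExponent`
(`exists_isRestrictionMeasure_of_isHullMultiplicative_of_lemma35`), so that the density fact
below is the only clause of Lemma 3.5 — and the only ingredient of the proof of Prop. 3.3 —
that remains a named fact.

## References

* [LSW] Lemma 3.5 and the proof of Prop. 3.3, arXiv pp. 11–13 [LawlerSchrammWerner2003Restriction].
-/

noncomputable section

open Set Filter Topology Metric Complex Bornology MeasureTheory
open UpperHalfPlane (upperHalfPlaneSet isOpen_upperHalfPlaneSet)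
open scoped NNReal Pointwise ENNReal ComplexConjugate

namespace Literature.Probability.RandomPlanarGeometry

open RestrictionConfig

/-! ### The semigroup `𝒜₀` -/

/-- **`A ∈ 𝒜₀`** ([LSW] proof of Prop. 3.3, p. 11: "the semigroup `𝒜₀` generated by
`{λK_t : t ≥ 0, λ > 0}`"): the smallest class of sets containing the dilated hulls `λ K_t`
(`lswHull`, the hulls of the Loewner chain driven by `W_t = 1 - 2t`) and closed under the
product `A · A'` of `*`-hulls (`RestrictionConfig.IsHullProduct A A' B`: `B = A · A'`).
[cite: LawlerSchrammWerner2003Restriction, Prop. 3.3 proof (p. 11), the semigroup 𝒜₀] -/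
inductive IsLSWGenerated : Set ℂ → Prop
  | smul_lswHull {r : ℝ} (hr : 0 < r) (t : ℝ≥0) : IsLSWGenerated (r • lswHull t)
  | of_isHullProduct {A A' B : Set ℂ} (hA : IsLSWGenerated A) (hA' : IsLSWGenerated A')
      (hB : IsHullProduct A A' B) : IsLSWGenerated B

/-- `K_t ∈ 𝒜₀` (`λ = 1`). [cite: LawlerSchrammWerner2003Restriction, Prop. 3.3 proof (p. 11)] -/
theorem isLSWGenerated_lswHull (t : ℝ≥0) : IsLSWGenerated (lswHull t) := by
  simpa using IsLSWGenerated.smul_lswHull one_pos t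

/-- `K_{s+t} ∈ 𝒜₀` as the product `K_t · K_s` (non-vacuity of the product rule).
[cite: LawlerSchrammWerner2003Restriction, Prop. 3.3 proof (p. 11)] -/
example (s t : ℝ≥0) : IsLSWGenerated (lswHull (s + t)) :=
  (isLSWGenerated_lswHull t).of_isHullProduct (isLSWGenerated_lswHull s) (isHullProduct_lswHull s t)

/-- **`𝒜₀ ⊆ 𝒬*`**: every element of `𝒜₀` is a `*`-hull. [folklore] -/
theorem IsLSWGenerated.isStarHull {A : Set ℂ} (h : IsLSWGenerated A) : IsStarHull A := by
  induction h with
  | smul_lswHull hr t => exact (isStarHull_lswHull t).smul hr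
  | of_isHullProduct _ _ hB => exact hB.1

/-! ### The convergence of the proof of Lemma 3.5 -/

/-- **`A_n → A` in the sense of [LSW], proof of Lemma 3.5** (p. 12): "`Φ_{A_n}` converges to
`Φ_A` uniformly on compact subsets of `ℍ̄ ∖ A` and `⋃ₙ A_n` is bounded away from `0` and `∞`."
Here `Φ`, `Φ n` are restriction maps of `A`, `A_n` (data), and the convergence is spelled out
as: (i) `⋃ₙ A_n ⊆ {δ ≤ |z| ≤ 1/δ}`; (ii) every compact `S ⊆ ℍ ∖ A` is eventually disjoint from
`A_n` (so that `Φ_{A_n}` is defined on `S`) and `Φ_{A_n} → Φ_A` uniformly on `S`; (iii) at the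
marked boundary point: `Φ_{A_n} → Φ_A` uniformly on a half-disc `B(0, ρ) ∩ ℍ` (which, the maps
extending continuously and by Schwarz reflection across `(-ρ, ρ)`, is uniform convergence on
the compact subsets `B̄(0, ρ') ∩ ℍ̄`, `ρ' < ρ`, of `ℍ̄ ∖ A`). Compact subsets of `ℍ̄ ∖ A`
meeting the real segment `[x₀, x₁]` spanned by `A ∩ ℝ` are deliberately not included: the
printed proof replaces `A` by `A' = A ∪ [x₀, x₁]` (p. 13) and its hulls `E_δ` contain that
segment; the two uses of the convergence in the proof of Lemma 3.5 (`Φ'_{A_n}(0) → Φ'_A(0)` by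
reflection at `0`, and the sets `A_n^±`, which lie in `ℍ`) only involve (ii) and (iii).
[cite: LawlerSchrammWerner2003Restriction, proof of Lemma 3.5 (p. 12), definition of convergence] -/
def LSWConverges (A : Set ℂ) (Φ : ConformalEquiv (upperHalfPlaneSet \ A) upperHalfPlaneSet)
    (An : ℕ → Set ℂ) (Φn : ∀ n, ConformalEquiv (upperHalfPlaneSet \ An n) upperHalfPlaneSet) :
    Prop :=
  (∃ δ : ℝ, 0 < δ ∧ ∀ n, An n ⊆ {z : ℂ | δ ≤ ‖z‖ ∧ ‖z‖ ≤ δ⁻¹}) ∧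
    (∀ S : Set ℂ, IsCompact S → S ⊆ upperHalfPlaneSet \ A →
      (∀ᶠ n in atTop, Disjoint S (An n)) ∧
        TendstoUniformlyOn (fun n ↦ (Φn n : ℂ → ℂ)) Φ atTop S) ∧
    ∃ ρ : ℝ, 0 < ρ ∧
      TendstoUniformlyOn (fun n ↦ (Φn n : ℂ → ℂ)) Φ atTop (upperHalfPlaneSet ∩ ball (0 : ℂ) ρ)

namespace LSWConverges

variable {A : Set ℂ} {Φ : ConformalEquiv (upperHalfPlaneSet \ A) upperHalfPlaneSet}
  {An : ℕ → Set ℂ} {Φn : ∀ n, ConformalEquiv (upperHalfPlaneSet \ An n) upperHalfPlaneSet}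

/-- The hulls `A_n` are bounded away from `0` and `∞`. [folklore] -/
theorem exists_bound (h : LSWConverges A Φ An Φn) :
    ∃ δ : ℝ, 0 < δ ∧ ∀ n, An n ⊆ {z : ℂ | δ ≤ ‖z‖ ∧ ‖z‖ ≤ δ⁻¹} :=
  h.1

/-- Compact subsets of `ℍ ∖ A` are eventually disjoint from `A_n`. [folklore] -/
theorem eventually_disjoint (h : LSWConverges A Φ An Φn) {S : Set ℂ} (hS : IsCompact S)
    (hSA : S ⊆ upperHalfPlaneSet \ A) : ∀ᶠ n in atTop, Disjoint S (An n) :=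
  (h.2.1 S hS hSA).1

/-- Uniform convergence `Φ_{A_n} → Φ_A` on compact subsets of `ℍ ∖ A`. [folklore] -/
theorem tendstoUniformlyOn (h : LSWConverges A Φ An Φn) {S : Set ℂ} (hS : IsCompact S)
    (hSA : S ⊆ upperHalfPlaneSet \ A) :
    TendstoUniformlyOn (fun n ↦ (Φn n : ℂ → ℂ)) Φ atTop S :=
  (h.2.1 S hS hSA).2

/-- Uniform convergence on a half-disc about `0`. [folklore] -/
theorem exists_tendstoUniformlyOn_ball (h : LSWConverges A Φ An Φn) :
    ∃ ρ : ℝ, 0 < ρ ∧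
      TendstoUniformlyOn (fun n ↦ (Φn n : ℂ → ℂ)) Φ atTop (upperHalfPlaneSet ∩ ball (0 : ℂ) ρ) :=
  h.2.2

/-- Locally uniform convergence on the open set `ℍ ∖ A`. [folklore] -/
theorem tendstoLocallyUniformlyOn (h : LSWConverges A Φ An Φn) (hA : IsClosed A) :
    TendstoLocallyUniformlyOn (fun n ↦ (Φn n : ℂ → ℂ)) Φ atTop (upperHalfPlaneSet \ A) := by
  rw [tendstoLocallyUniformlyOn_iff_forall_isCompact (isOpen_upperHalfPlaneSet.sdiff hA)]
  exact fun K hKU hK ↦ h.tendstoUniformlyOn hK hKU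

end LSWConverges

/-- A ball `B(0, 2r)`, `2r ≤ δ`, misses sets bounded below in norm by `δ`. [folklore] -/
theorem disjoint_ball_of_norm_le {An : ℕ → Set ℂ} {δ : ℝ}
    (hδ : ∀ n, An n ⊆ {z : ℂ | δ ≤ ‖z‖ ∧ ‖z‖ ≤ δ⁻¹}) {r : ℝ} (hr : 2 * r ≤ δ) (n : ℕ) :
    Disjoint (ball (0 : ℂ) (2 * r)) (An n) :=
  Set.disjoint_left.2 fun z hz hzA ↦ by
    have h1 := (hδ n hzA).1
    rw [mem_ball_zero_iff] at hz
    linarith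

/-! ### Named fact: `𝒜₀` is dense in `𝒬₊` -/

/-- NAMED FACT — **`𝒜₀` is dense in `𝒬₊`** ([LSW] Lemma 3.5, density part; proof pp. 12–13,
concluding "Hence, `𝒜₀` is dense in `𝒬₊` and Lemma 3.5 is established"): for every `A ∈ 𝒬₊`
with restriction map `Φ_A` there are `A_n ∈ 𝒜₀` with restriction maps `Φ_{A_n}` such that
`A_n → A` in the sense of the proof of Lemma 3.5 (`LSWConverges`). The printed proof: for
`A' = A ∪ [x₀, x₁]` and `δ ↓ 0` the hulls `E_δ = cl(A ∪ Φ_A⁻¹(D_δ))` converge to `A`; `E_δ ∩ ℍ`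
is a simple path `β`, parametrized by half-plane capacity, whose maps `Φ_t = Φ_{β[0,t]}`
satisfy the Loewner equation `∂_t Φ_t = 2Φ_t/((Φ_t - Ũ_t)Ũ_t)` with `Ũ_t` continuous and
positive; approximating `Ũ` uniformly by piecewise constant functions gives solutions
`Φ^{(n)}_s → Φ_s = Φ_{E_δ}` locally uniformly in `ℍ̄ ∖ E_δ`, and "the solution with `Ũ_t`
constant is of the form `G^λ_{t'}`", so `Φ^{(n)}_s ∈ 𝒜₀`. (Loewner's slit theorem and the
stability of the Loewner flow; not in the tree.)
[cite: LawlerSchrammWerner2003Restriction, Lemma 3.5 (p. 12) and its proof (pp. 12–13), density of 𝒜₀] -/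
def IsPlusHull.exists_isLSWGenerated_lswConverges : Prop :=
  ∀ {A : Set ℂ}, IsPlusHull A →
    ∀ {Φ : ConformalEquiv (upperHalfPlaneSet \ A) upperHalfPlaneSet}, IsRestrictionMap A Φ →
      ∃ (An : ℕ → Set ℂ) (Φn : ∀ n, ConformalEquiv (upperHalfPlaneSet \ An n) upperHalfPlaneSet),
        (∀ n, IsLSWGenerated (An n)) ∧ (∀ n, IsRestrictionMap (An n) (Φn n)) ∧
          LSWConverges A Φ An Φn

/-! ### `Φ'_{A_n}(0) → Φ'_A(0)` -/

section Deriv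

variable {A : Set ℂ} {Φ : ConformalEquiv (upperHalfPlaneSet \ A) upperHalfPlaneSet}
  {An : ℕ → Set ℂ} {Φn : ∀ n, ConformalEquiv (upperHalfPlaneSet \ An n) upperHalfPlaneSet}

/-- Uniform convergence on a ball, from uniform convergence off the real axis and continuity
(points of the ball are limits of points of the ball off the axis). [folklore] -/
theorem tendstoUniformlyOn_ball_of_off_real {G : ℕ → ℂ → ℂ} {g : ℂ → ℂ} {r : ℝ}
    (hG : ∀ n, ContinuousOn (G n) (ball (0 : ℂ) r)) (hg : ContinuousOn g (ball (0 : ℂ) r))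
    (h : TendstoUniformlyOn G g atTop (ball (0 : ℂ) r ∩ {z | z.im ≠ 0})) :
    TendstoUniformlyOn G g atTop (ball (0 : ℂ) r) := by
  rw [Metric.tendstoUniformlyOn_iff] at h ⊢
  intro ε hε
  filter_upwards [h (ε / 2) (half_pos hε)] with n hn z hz
  -- `z` is in the closure of `ball ∩ {im ≠ 0}`
  set D := ball (0 : ℂ) r ∩ {z : ℂ | z.im ≠ 0}
  have hzcl : z ∈ closure D := by
    have hpath : Tendsto (fun t : ℝ ↦ z + I * t) (𝓝[>] 0) (𝓝 z) := by
      have : Continuous fun t : ℝ ↦ z + I * t := by fun_prop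
      simpa using (this.tendsto 0).mono_left nhdsWithin_le_nhds
    refine mem_closure_of_tendsto hpath ?_
    have hzr : ‖z‖ < r := mem_ball_zero_iff.1 hz
    have hev1 : ∀ᶠ t : ℝ in 𝓝[>] 0, t < r - ‖z‖ :=
      nhdsWithin_le_nhds (eventually_lt_nhds (by linarith))
    have hev2 : ∀ᶠ t : ℝ in 𝓝[>] 0, z.im + t ≠ 0 := by
      rcases eq_or_ne z.im 0 with h0 | h0
      · filter_upwards [self_mem_nhdsWithin] with t ht
        rw [h0, zero_add]; exact ne_of_gt ht
      · have : ContinuousAt (fun t : ℝ ↦ z.im + t) 0 := by fun_prop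
        have h1 : ∀ᶠ t : ℝ in 𝓝 0, z.im + t ≠ 0 := this.eventually_ne (by simpa using h0)
        exact nhdsWithin_le_nhds h1
    filter_upwards [hev1, hev2, self_mem_nhdsWithin] with t ht ht' ht0
    refine ⟨?_, ?_⟩
    · rw [mem_ball_zero_iff]
      calc ‖z + I * t‖ ≤ ‖z‖ + ‖I * (t : ℂ)‖ := norm_add_le _ _
        _ = ‖z‖ + t := by simp [abs_of_pos (show (0 : ℝ) < t from ht0)]
        _ < r := by linarith
    · show (z + I * t).im ≠ 0
      simpa using ht'
  haveI : (𝓝[D] z).NeBot := mem_closure_iff_nhdsWithin_neBot.1 hzcl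
  have h1 : Tendsto (fun w ↦ dist (g w) (G n w)) (𝓝[D] z) (𝓝 (dist (g z) (G n z))) := by
    have hcg : ContinuousWithinAt g D z :=
      (hg.continuousAt (isOpen_ball.mem_nhds hz)).continuousWithinAt
    have hcG : ContinuousWithinAt (G n) D z :=
      ((hG n).continuousAt (isOpen_ball.mem_nhds hz)).continuousWithinAt
    exact hcg.dist hcG
  have h2 : dist (g z) (G n z) ≤ ε / 2 :=
    le_of_tendsto h1 (eventually_nhdsWithin_of_forall fun w hw ↦ (hn w hw).le)
  linarith

variable (hA : IsStarHull A) (hAn : ∀ n, IsStarHull (An n)) (hΦ : IsRestrictionMap A Φ)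
  (hΦn : ∀ n, IsRestrictionMap (An n) (Φn n))
include hA hAn hΦ hΦn

/-- **The reflected extensions converge uniformly on a disc about `0`.** With `B(0, 2r)`
missing `A` and all `A_n`, and `Φ_{A_n} → Φ_A` uniformly on the closed upper half-disc of
radius `r` (minus the axis), the Schwarz reflections `G_n → G` uniformly on `B(0, r)`.
[cite: LawlerSchrammWerner2003Restriction, proof of Lemma 3.5 (p. 12), Schwarz reflection] -/
theorem tendstoUniformlyOn_reflectExt {r : ℝ} (hr : Disjoint (ball (0 : ℂ) (2 * r)) A)
    (hrn : ∀ n, Disjoint (ball (0 : ℂ) (2 * r)) (An n))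
    (hconv : TendstoUniformlyOn (fun n ↦ (Φn n : ℂ → ℂ)) Φ atTop
      (upperHalfPlaneSet ∩ ball (0 : ℂ) r)) :
    TendstoUniformlyOn (fun n ↦ reflectExt (hAn n) (hΦn n) (hrn n)) (reflectExt hA hΦ hr) atTop
      (ball (0 : ℂ) r) := by
  refine tendstoUniformlyOn_ball_of_off_real
    (fun n ↦ (differentiableOn_reflectExt (hAn n) (hΦn n) (hrn n)).continuousOn)
    (differentiableOn_reflectExt hA hΦ hr).continuousOn ?_
  rw [Metric.tendstoUniformlyOn_iff] at hconv ⊢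
  intro ε hε
  filter_upwards [hconv ε hε] with n hn z hz
  obtain ⟨hzr, hzim⟩ := hz
  rcases lt_or_gt_of_ne (show z.im ≠ 0 from hzim) with hneg | hpos
  · -- lower half-disc: `G(z) = conj Φ(conj z)`
    have hcz : conj z ∈ upperHalfPlaneSet ∩ ball (0 : ℂ) r :=
      ⟨by show 0 < (conj z).im; rw [conj_im]; linarith,
        by rwa [mem_ball_zero_iff, norm_conj, ← mem_ball_zero_iff]⟩
    have hc : 0 ≤ (conj z).im := (show 0 < (conj z).im from hcz.1).le
    have h1 : reflectExt hA hΦ hr z = conj (Φ (conj z)) := by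
      have := reflectExt_eq hA hΦ hr hcz
      simp only [reflectExt, if_neg (not_le.2 hneg)]
      simp only [reflectExt, if_pos hc] at this
      rw [this]
    have h2 : reflectExt (hAn n) (hΦn n) (hrn n) z = conj (Φn n (conj z)) := by
      have := reflectExt_eq (hAn n) (hΦn n) (hrn n) hcz
      simp only [reflectExt, if_neg (not_le.2 hneg)]
      simp only [reflectExt, if_pos hc] at this
      rw [this]
    rw [h1, h2, dist_conj_conj]
    exact hn (conj z) hcz
  · have hz' : z ∈ upperHalfPlaneSet ∩ ball (0 : ℂ) r := ⟨hpos, hzr⟩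
    rw [reflectExt_eq hA hΦ hr hz', reflectExt_eq (hAn n) (hΦn n) (hrn n) hz']
    exact hn z hz'

/-- **`Φ'_{A_n}(0) → Φ'_A(0)` under the convergence of Lemma 3.5** ([LSW] p. 12: "It is
immediate that `Φ'_{A_n}(0) → Φ'_A(0)`, by Cauchy's derivative formula (the maps may be
extended to a neighborhood of `0` by Schwarz reflection in the real line)"): the reflected
extensions converge uniformly on a disc about `0`, hence their derivatives at `0` converge.
[cite: LawlerSchrammWerner2003Restriction, proof of Lemma 3.5 (p. 12)] -/
theorem LSWConverges.tendsto_restrictionDeriv (h : LSWConverges A Φ An Φn) {d : ℝ} {dn : ℕ → ℝ}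
    (hd : HasRestrictionDeriv A Φ d) (hdn : ∀ n, HasRestrictionDeriv (An n) (Φn n) (dn n)) :
    Tendsto dn atTop (𝓝 d) := by
  obtain ⟨δ, hδ, hAnδ⟩ := h.exists_bound
  obtain ⟨r₁, hr₁, hr₁A⟩ := hA.exists_disjoint_ball
  obtain ⟨ρ, hρ, hconv⟩ := h.exists_tendstoUniformlyOn_ball
  -- a common radius
  set r := min (min r₁ (δ / 2)) ρ with hr_def
  have hr0 : 0 < r := lt_min (lt_min hr₁ (by positivity)) hρ
  have hr₁' : r ≤ r₁ := (min_le_left _ _).trans (min_le_left _ _)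
  have hrδ : r ≤ δ / 2 := (min_le_left _ _).trans (min_le_right _ _)
  have hrρ : r ≤ ρ := min_le_right _ _
  have hrA : Disjoint (ball (0 : ℂ) (2 * r)) A :=
    hr₁A.mono_left (ball_subset_ball (by linarith))
  have hrn : ∀ n, Disjoint (ball (0 : ℂ) (2 * r)) (An n) :=
    disjoint_ball_of_norm_le hAnδ (by linarith)
  -- uniform convergence on the upper half-disc of radius `r`
  have hconv' : TendstoUniformlyOn (fun n ↦ (Φn n : ℂ → ℂ)) Φ atTop
      (upperHalfPlaneSet ∩ ball (0 : ℂ) r) :=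
    hconv.mono (inter_subset_inter_right _ (ball_subset_ball hrρ))
  have hG := tendstoUniformlyOn_reflectExt hA hAn hΦ hΦn hrA hrn hconv'
  -- derivatives converge locally uniformly on the open disc
  have hGloc : TendstoLocallyUniformlyOn (fun n ↦ reflectExt (hAn n) (hΦn n) (hrn n))
      (reflectExt hA hΦ hrA) atTop (ball (0 : ℂ) r) :=
    hG.tendstoLocallyUniformlyOn
  have hderiv := hGloc.deriv (Eventually.of_forall fun n ↦
    differentiableOn_reflectExt (hAn n) (hΦn n) (hrn n)) isOpen_ball
  have h0 := hderiv.tendsto_at (mem_ball_self hr0)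
  simp only [Function.comp_def, deriv_reflectExt_zero hA hΦ hrA hr0 hd,
    fun n ↦ deriv_reflectExt_zero (hAn n) (hΦn n) (hrn n) hr0 (hdn n)] at h0
  -- `(dn n : ℂ) → (d : ℂ)` gives `dn n → d`
  have := (continuous_re.tendsto _).comp h0
  simpa [Function.comp_def] using this

end Deriv

/-! ### `F = Φ'(0)^α` on `𝒜₀` -/

section Semigroup

variable {P : Measure RestrictionConfig}

/-- The number `Φ'_A(0)` does not depend on the restriction map used to compute it (the maps
agree on `ℍ ∖ A`, `IsStarHull.existsUnique_isRestrictionMap_holds`). [folklore] -/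
theorem restrictionDeriv_eq_of_isRestrictionMap {A : Set ℂ} (hA : IsStarHull A)
    {Φ Ψ : ConformalEquiv (upperHalfPlaneSet \ A) upperHalfPlaneSet} (hΦ : IsRestrictionMap A Φ)
    (hΨ : IsRestrictionMap A Ψ) {d e : ℝ} (hd : HasRestrictionDeriv A Φ d)
    (he : HasRestrictionDeriv A Ψ e) : d = e := by
  obtain ⟨Φ₀, -, hU⟩ := IsStarHull.existsUnique_isRestrictionMap_holds hA
  have hd' : HasRestrictionDeriv A Φ₀ d :=
    hd.congr' (eventually_nhdsWithin_of_forall fun z hz ↦ by rw [hU Φ hΦ hz])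
  have he' : HasRestrictionDeriv A Φ₀ e :=
    he.congr' (eventually_nhdsWithin_of_forall fun z hz ↦ by rw [hU Ψ hΨ hz])
  exact hd'.unique hA he'

/-- **The derivative of a product is determined**: if `B = A · A'` then `Φ'_B(0) = Φ'_A(0) Φ'_{A'}(0)`
for the derivatives computed from ANY restriction maps of `A`, `A'`, `B`.
[cite: LawlerSchrammWerner2003Restriction, Prop. 3.3 proof (p. 11), Φ'_{A₁·A₂}(0) = Φ'_{A₁}(0)Φ'_{A₂}(0)] -/
theorem IsHullProduct.restrictionDeriv_eq {A A' B : Set ℂ} (hA : IsStarHull A) (hA' : IsStarHull A')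
    (hB : IsHullProduct A A' B)
    {ΦA : ConformalEquiv (upperHalfPlaneSet \ A) upperHalfPlaneSet} (hΦA : IsRestrictionMap A ΦA)
    {ΦA' : ConformalEquiv (upperHalfPlaneSet \ A') upperHalfPlaneSet} (hΦA' : IsRestrictionMap A' ΦA')
    {ΦB : ConformalEquiv (upperHalfPlaneSet \ B) upperHalfPlaneSet} (hΦB : IsRestrictionMap B ΦB)
    {dA dA' dB : ℝ} (hdA : HasRestrictionDeriv A ΦA dA) (hdA' : HasRestrictionDeriv A' ΦA' dA')
    (hdB : HasRestrictionDeriv B ΦB dB) : dB = dA * dA' := by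
  obtain ⟨hBstar, Φ', hΦ', hset⟩ := hB
  -- `B` is the constructed product hull for the map `Φ'`
  have hBeq : B = hullProduct A A' Φ' := by
    refine hBstar.1.eq_of_diff_eq (hA.hullProduct hA' hΦ').1 ?_
    rw [hset, diff_hullProduct hA.1.isClosed hA'.1.isClosed]
  subst hBeq
  -- the derivative of `A'` for the map `Φ'`
  obtain ⟨e', -, -, he'⟩ := IsStarHull.exists_hasRestrictionDeriv_holds hA' hΦ'
  have hee : e' = dA' := restrictionDeriv_eq_of_isRestrictionMap hA' hΦ' hΦA' he' hdA'
  have hprod := HasRestrictionDeriv.hullProduct hA.1.isClosed hA'.1.isClosed hΦ' hdA he'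
  have hmap := IsRestrictionMap.hullProduct hA.1.isClosed hA'.1.isClosed hΦA hΦ'
  rw [restrictionDeriv_eq_of_isRestrictionMap hBstar hΦB hmap hdB hprod, hee]

/-- **`F(Φ_A) = Φ_A'(0)^α` on `𝒜₀`** ([LSW] proof of Prop. 3.3, p. 11: "`F(G_t) = G_t'(0)^α`.
… By our assumption of scale invariance of the law of `K`, we have
`F(G_t^λ) = F(G_t) = G_t'(0)^α = (G_t^λ)'(0)^α`. We may therefore conclude that
`F(Φ_A) = Φ_A'(0)^α` for every `A` in the semigroup `𝒜₀`"). Here `F(A) = P[K ∩ A = ∅]` for a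
measure `P` on `Ω` which is multiplicative over products and dilation invariant, with
`F(K_t) = e^{-2αt}`; the induction uses `Φ'_{λK_t}(0) = e^{-2t}` and the chain rule.
[cite: LawlerSchrammWerner2003Restriction, Prop. 3.3 proof (p. 11)] -/
theorem IsLSWGenerated.measure_avoid_eq_rpow (hmul : IsHullMultiplicative P) (hsc : IsScaleInvariant P)
    {α : ℝ} (hK : ∀ t : ℝ≥0, P (avoid (lswHull t)) = ENNReal.ofReal (Real.exp (-2 * α * t)))
    {A : Set ℂ} (hgen : IsLSWGenerated A) :
    ∀ {Φ : ConformalEquiv (upperHalfPlaneSet \ A) upperHalfPlaneSet}, IsRestrictionMap A Φ →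
      ∀ {d : ℝ}, HasRestrictionDeriv A Φ d → P (avoid A) = ENNReal.ofReal (d ^ α) := by
  induction hgen with
  | @smul_lswHull r hr t =>
    intro Φ hΦ d hd
    obtain ⟨hstar, hmap, hder⟩ := hasRestrictionDeriv_smul_lswHull hr t
    have hdeq : d = Real.exp (-2 * t) := restrictionDeriv_eq_of_isRestrictionMap hstar hΦ hmap hd hder
    rw [hsc _ (isStarHull_lswHull t) r hr, hK t, hdeq, ← Real.exp_mul]
    congr 2
    ring
  | @of_isHullProduct A₁ A₂ B h₁ h₂ hB ih₁ ih₂ =>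
    intro Φ hΦ d hd
    have hA₁ := h₁.isStarHull
    have hA₂ := h₂.isStarHull
    obtain ⟨Φ₁, hΦ₁, -⟩ := IsStarHull.existsUnique_isRestrictionMap_holds hA₁
    obtain ⟨Φ₂, hΦ₂, -⟩ := IsStarHull.existsUnique_isRestrictionMap_holds hA₂
    obtain ⟨d₁, hd₁0, -, hd₁⟩ := IsStarHull.exists_hasRestrictionDeriv_holds hA₁ hΦ₁
    obtain ⟨d₂, hd₂0, -, hd₂⟩ := IsStarHull.exists_hasRestrictionDeriv_holds hA₂ hΦ₂
    have hdB : d = d₁ * d₂ := IsHullProduct.restrictionDeriv_eq hA₁ hA₂ hB hΦ₁ hΦ₂ hΦ hd₁ hd₂ hd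
    rw [hmul A₁ A₂ B hA₁ hA₂ hB, ih₁ hΦ₁ hd₁, ih₂ hΦ₂ hd₂, hdB,
      ← ENNReal.ofReal_mul (Real.rpow_nonneg hd₁0.le α), Real.mul_rpow hd₁0.le hd₂0.le]

end Semigroup

end Literature.Probability.RandomPlanarGeometry

end
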